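import Mathlib.Analysis.Complex.Cardinality
import Literature.NumberTheory.EllipticCurves.ModularCurve
import HarnessLib

/-!
# Discharge of `ModularParametrizationData.maninConstant_ne_zero` (the Manin constant is non-zero)

The named fact `Literature.NumberTheory.EllipticCurves.ModularForms.ModularParametrizationData.maninConstant_ne_zero` of
`Literature/NumberTheory/EllipticCurves/ModularCurve.lean` — the Manin constant `c ∈ ℤ` of a
modular parametrisation datum `D` (characterised by `φ^* ω_E = c · 2πi f(τ) dτ`, i.e.
`c Λ_f ⊆ Λ_E`) is non-zero — is proved here from the fields of the datum alone, by the argument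
recorded in its docstring: if `c = 0` then `φ(τ) = uniformize (c · 2πi ∫_{i∞}^τ f)` is constantly
`O`, so `finite_compl_range_φ` (the degree axiom `deg_spec` with `0 < deg`) makes `E(ℂ)` finite;
but `uniformize : ℂ →+ E(ℂ)` has kernel the period lattice `Λ_E` (`ker_uniformize`), so every
`z ∈ ℂ` would have a multiple `n z ∈ Λ_E` with `n ≥ 1`, exhibiting `ℂ` inside the countable set
`⋃ₙ n⁻¹ Λ_E` (`Λ_E` is discrete in `ℂ`, hence countable) — contradicting
`not_countable_complex`.  In print: Edixhoven 1991, §1 (the Manin constant is a non-zero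
integer; for the strong Weil curve `c ∈ ℤ_{≥ 1}` after a sign choice).  Kept in a sibling file so
that `ModularCurve.lean` does not import `Mathlib.Analysis.Complex.Cardinality`.

Users of the fact (`Literature.NumberTheory.EllipticCurves.grossZagierConstant_pos`, `Literature.NumberTheory.EllipticCurves.maninConstant_ne_zero'`,
`Literature.NumberTheory.EllipticCurves.GrossZagierFormula.lDerivEK_eq_zero_iff`) take `(hc : D.maninConstant_ne_zero)` and are fed
`D.maninConstant_ne_zero_holds`.

## References

* B. Edixhoven, *On the Manin constants of modular elliptic curves*, in *Arithmetic algebraic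
  geometry (Texel, 1989)*, Progr. Math. 89, Birkhäuser (1991), 25–39, §1. [EdixhovenManin1991]
-/

noncomputable section

namespace Literature.NumberTheory.EllipticCurves.ModularForms.ModularParametrizationData

variable {W : WeierstrassCurve ℚ} {N : ℕ} [NeZero N]

/-- If the Manin constant vanished, the parametrisation `φ` would be constantly `O`. [folklore] -/
theorem φ_eq_zero_of_maninConstant_eq_zero (D : ModularParametrizationData W N)
    (hc : D.maninConstant = 0) (τ : UpperHalfPlane) : D.φ τ = 0 := by
  have hc' : D.c = 0 := hc
  simp [φ, hc']

/-- `E(ℂ)` is infinite: `uniformize : ℂ →+ E(ℂ)` is onto with kernel the (countable) lattice `Λ_E`,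
and `ℂ` is uncountable (Silverman AEC VI.5.1: `E(ℂ) ≅ ℂ/Λ`). [folklore] -/
theorem infinite_point (D : ModularParametrizationData W N) :
    Infinite (W.baseChange ℂ).toAffine.Point := by
  rw [← not_finite_iff_infinite]
  intro hfin
  have hΛ : (D.L.lattice : Set ℂ).Countable := countable_of_Lindelof_of_discrete (X := D.L.lattice)
  refine not_countable_complex
    ((Set.countable_iUnion fun n : ℕ ↦ hΛ.image fun l : ℂ ↦ l / (n : ℂ)).mono fun z _ ↦ ?_)
  obtain ⟨n, hn, hnz⟩ := (isOfFinAddOrder_of_finite (D.uniformize z)).exists_nsmul_eq_zero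
  rw [← map_nsmul, D.uniformize_eq_zero_iff, nsmul_eq_mul] at hnz
  have hn' : (n : ℂ) ≠ 0 := by exact_mod_cast hn.ne'
  exact Set.mem_iUnion.mpr ⟨n, _, hnz, mul_div_cancel_left₀ z hn'⟩

/-- **Discharge of `maninConstant_ne_zero`**: the Manin constant of a modular parametrisation
datum is non-zero (Edixhoven 1991, §1). If `c = 0` then `φ ≡ O`
(`φ_eq_zero_of_maninConstant_eq_zero`), so `E(ℂ) ⊆ (range φ)ᶜ ∪ {O}` is finite by
`finite_compl_range_φ`, contradicting `infinite_point`. [cite: EdixhovenManin1991, §1] -/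
theorem maninConstant_ne_zero_holds (D : ModularParametrizationData W N) :
    D.maninConstant_ne_zero := by
  intro hc
  have hφ := D.φ_eq_zero_of_maninConstant_eq_zero hc
  refine D.infinite_point.not_finite (Set.finite_univ_iff.mp
    ((D.finite_compl_range_φ.union (Set.finite_singleton 0)).subset fun P _ ↦ ?_))
  by_cases hP : P = 0
  · exact Or.inr (Set.mem_singleton_iff.mpr hP)
  · exact Or.inl fun ⟨τ, hτ⟩ ↦ hP (hτ.symm.trans (hφ τ))

end Literature.NumberTheory.EllipticCurves.ModularForms.ModularParametrizationData

end
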